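import Summits.BirchSwinnertonDyer.BirchSwinnertonDyer.Theorems.ResidualThetaTransportAtTwoRlfTwistedLiftPlusTwo
import Summits.BirchSwinnertonDyer.BirchSwinnertonDyer.Theorems.ResidualThetaTransportAtTwoRlfTwistedEventualPlusLiftOfPoitouTate
import HarnessLib

/-!
# Road T for item 23110: (LIFT⁺₂)(u) from ANY eventual global `+`-lifting at the place above `2` — the binder-robust form of
# `…RlfTwistedLiftPlusTwo` — and (LIFT⁺₂)(u) ⟸ H-PLUSDUAL-nondeg(u) ∧ H-FIN(u) through the lead's
# `TwistedPT.liftPlusEventual_two_of_plusDualNondeg_of_eigen` (p661592)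

Route `ResidualThetaTransportAtTwo` (RTT, crux r201 `ResidualLambdaFormulaNegDiscAtTwo`, stmt-BirchSwinnertonDyer-23110) /
`ThetaPartnerAtTwo` (TP2). Seat `prover-bsd-wall-tp2-p2x-w3` g12; `--supports stmt-BirchSwinnertonDyer-23110`. THEOREMS ONLY (no
definition, no named fact, no `sorry`); route-independent; closes nothing.

The `±`-duality hypothesis `hdual` of road T is being settled between the lead and seat w2 in successively weaker forms (`hdual` of
p660516; `hdual` WITH `hnondeg` of p661143 `…UniformExponentNondeg`; possibly with `halt` next). To keep (LIFT⁺₂) decoupled from that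
binder, this file proves it from the OUTPUT of the global half alone:

* `liftPlusTwo_of_liftPlusEventual` — `E/ℚ` globally minimal, `GoodSS E 2`, `a₂ = 0`, cyclotomic `κ` with topological generator `γ`,
  `u` odd; GIVEN the eventual global `+`-lifting at the place above `2` «for every `J` and every family of local targets
  `(x_v)_v` of level `J` there are `J' ≥ J` and `x ∈ H¹(Γ_ℚ, E[2^{J'}](χ_u))` with `twistedTorsionToH1 x ∈ H = unramifiedOutside …`
  and `res_v x − H¹(ι) x_v ∈ twistedTorsionLocalKummer … (⨆ₙ E⁺_n)` at every `v ∋ 2`» (= the conclusion of the lead's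
  `liftPlusEventual_two_of_plusDualNondeg_of_eigen` at `ε = 1`, and of `exists_mem_selmerGroup_relaxed_sub_map_incl_mem_localKummer_of_poitouTate`),
  (LIFT⁺₂)(u) HOLDS: (R3) `exists_twistedTorsion_localLift_plusKummer_two_incl` at the place `v₀` above `2` (lift `g` of `γ`,
  `conj_γ = conj_{res g}`), `c' = twistedTorsionToH1 x`, `u·conj_γ c' = c'` (`zsmul_conjH1_twistedTorsionToH1`), `c − c' ∈ K₂⁺` (the `⨅_σ`
  for free: `mem_iInf_comap_conjH1_localKummer_of_forall_mem`; uniqueness of the place above `2`).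
* `liftPlusTwo_of_plusDualNondeg_of_eigen` — (LIFT⁺₂)(u) ⟸ `hdual`-with-`hnondeg`(u) ∧ `hfinE`(u) (the binders VERBATIM those of
  `liftPlusEventual_two_of_plusDualNondeg_of_eigen` at `ε = 1`).

HONEST FRAMING: closes nothing; the global lifting / `hdual` / `hfinE` are NOT proved here; 23110 is NOT proved; BSD is not proved by any
of this. References: [GreenbergLNM1716] §4 Props. 4.13–4.14 and p. 124; [Howard2004HeegnerKolyvagin] Thm. 2.1.11; [Kobayashi2003] Def. 1.1,
§8.4; B. D. Kim, Compositio Math. 143 (2007), Props. 3.15–3.18.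
-/

-- the Theorems namespace of this sub repeats the summit name by design (D-0017 nested layout)
set_option linter.dupNamespace false

noncomputable section

open scoped Classical NumberField

open NumberField IsDedekindDomain Field
open Literature.NumberTheory.EllipticCurves Literature.NumberTheory.GaloisRepresentations
  Literature.NumberTheory.GaloisCohomology WeierstrassCurve ZpExtension Literature.NumberTheory.EllipticCurves.Kobayashi2003
  Literature.NumberTheory.EllipticCurves.GreenbergVatsal2000
open Literature.NumberTheory.GaloisRepresentations.DiscreteGaloisModule (localTatePairingZMod unramifiedSubgroup
  SelmerStructure TateDual tateDual)

namespace Summit.BirchSwinnertonDyer.BirchSwinnertonDyer.Theorems.SignedEC.TwistedPT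

/-- Places of `ℚ` containing `2` coincide (maximality of `(2) ⊂ 𝓞 ℚ ≅ ℤ`). [cite: SerreLocalFields1979, I §1] -/
private theorem eq_of_two_mem_asIdeal' {v v' : HeightOneSpectrum (𝓞 ℚ)} (hv : ((2 : ℕ) : 𝓞 ℚ) ∈ v.asIdeal)
    (hv' : ((2 : ℕ) : 𝓞 ℚ) ∈ v'.asIdeal) : v = v' := by
  have hprime : Prime ((2 : ℕ) : 𝓞 ℚ) := by
    rw [← MulEquiv.prime_iff (Rat.ringOfIntegersEquiv : 𝓞 ℚ ≃+* ℤ).toMulEquiv]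
    change Prime (Rat.ringOfIntegersEquiv ((2 : ℕ) : 𝓞 ℚ))
    rw [map_natCast, ← Nat.prime_iff_prime_int]
    exact Nat.prime_two
  have hspan : ∀ w : HeightOneSpectrum (𝓞 ℚ), ((2 : ℕ) : 𝓞 ℚ) ∈ w.asIdeal →
      Ideal.span {((2 : ℕ) : 𝓞 ℚ)} = w.asIdeal := fun w hw ↦ by
    have hP : (Ideal.span {((2 : ℕ) : 𝓞 ℚ)}).IsPrime := (Ideal.span_singleton_prime hprime.ne_zero).mpr hprime
    exact (hP.isMaximal (by rw [Ne, Ideal.span_singleton_eq_bot]; exact hprime.ne_zero)).eq_of_le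
      w.isPrime.ne_top ((Ideal.span_singleton_le_iff_mem _).mpr hw)
  exact HeightOneSpectrum.ext ((hspan v hv).symm.trans (hspan v' hv'))

set_option maxHeartbeats 800000 in
/-- **(LIFT⁺₂)(u) from ANY eventual global `+`-lifting at the place above `2`.** See the module docstring; the conclusion is VERBATIM the
`hlift` binder of `TwistedSurj.rlf2_of_twistedDescent`, the hypothesis `hev` VERBATIM the conclusion of
`liftPlusEventual_two_of_plusDualNondeg_of_eigen` at `ε = 1` (quantified over the level `J` and the local targets `x₂`).
[cite: GreenbergLNM1716, §4 Prop. 4.14 and p. 124] [cite: Kobayashi2003, Def. 1.1, §8.4] -/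
theorem liftPlusTwo_of_liftPlusEventual (E : WeierstrassCurve ℚ) [E.IsElliptic] [E.IsGloballyMinimal]
    (hss : Rank1Residual.GoodSS E 2) (ha : E.frobeniusTrace 2 = 0) (S₀ : Finset (HeightOneSpectrum (𝓞 ℚ)))
    (κ : ZpExtension ℚ 2) (hκ : κ.IsCyclotomic) {γ : Field.absoluteGaloisGroup ℚ} (hγ : κ.IsTopGenerator γ) (u : ℤ)
    (hu : (2 : ℤ) ∣ u - 1)
    (hev : ∀ (J : ℕ) (x₂ : ∀ v : HeightOneSpectrum (𝓞 ℚ),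
        galoisCohomology ((E.twistedTorsionGaloisModule 2 κ J u hu).restrictField (v.adicCompletion ℚ)) 1),
      ∃ (J' : ℕ) (hJ : J ≤ J') (x : galoisCohomology (E.twistedTorsionGaloisModule 2 κ J' u hu) 1),
        E.twistedTorsionToH1 2 κ J' u hu x ∈
            unramifiedOutside κ.kerSubgroup ↥(E.geomPrimaryTorsion 2) 2 (↑S₀ : Set (HeightOneSpectrum (𝓞 ℚ))) ∧
          ∀ v : HeightOneSpectrum (𝓞 ℚ), ((2 : ℕ) : 𝓞 ℚ) ∈ v.asIdeal →
            galoisCohomology.res (E.twistedTorsionGaloisModule 2 κ J' u hu) (v.adicCompletion ℚ) 1 x -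
                galoisCohomology.map ((E.twistedTorsionIncl 2 κ hJ u hu).restrictField (v.adicCompletion ℚ)) 1 (x₂ v) ∈
              E.twistedTorsionLocalKummer 2 κ J' u hu (v.adicCompletion ℚ) (⨆ n : ℕ, signedLocalPoints κ (v.adicCompletion ℚ) E 1 n)) :
    ∀ c ∈ unramifiedOutside κ.kerSubgroup ↥(E.geomPrimaryTorsion 2) 2 (↑S₀ : Set (HeightOneSpectrum (𝓞 ℚ))),
      u • E.conjH1 2 κ.kerSubgroup γ c - c ∈
        ⨅ (v : HeightOneSpectrum (𝓞 ℚ)) (_ : ((2 : ℕ) : 𝓞 ℚ) ∈ v.asIdeal) (σ : Field.absoluteGaloisGroup ℚ),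
          (localKummerOverOfEmb E 2 κ.kerSubgroup (closureEmb (K := ℚ) (v.adicCompletion ℚ))
            (⨆ n : ℕ, signedLocalPoints κ (v.adicCompletion ℚ) E 1 n)).comap (E.conjH1 2 κ.kerSubgroup σ) →
      ∃ c' ∈ unramifiedOutside κ.kerSubgroup ↥(E.geomPrimaryTorsion 2) 2 (↑S₀ : Set (HeightOneSpectrum (𝓞 ℚ))),
        u • E.conjH1 2 κ.kerSubgroup γ c' = c' ∧ c - c' ∈
          ⨅ (v : HeightOneSpectrum (𝓞 ℚ)) (_ : ((2 : ℕ) : 𝓞 ℚ) ∈ v.asIdeal) (σ : Field.absoluteGaloisGroup ℚ),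
            (localKummerOverOfEmb E 2 κ.kerSubgroup (closureEmb (K := ℚ) (v.adicCompletion ℚ))
              (⨆ n : ℕ, signedLocalPoints κ (v.adicCompletion ℚ) E 1 n)).comap (E.conjH1 2 κ.kerSubgroup σ) := by
  intro c hcH hψ
  -- no place above `2`? (never) — then `K₂⁺ = ⊤` and `c' = 0` does it
  by_cases hex : ∃ v₀ : HeightOneSpectrum (𝓞 ℚ), ((2 : ℕ) : 𝓞 ℚ) ∈ v₀.asIdeal
  swap
  · refine ⟨0, zero_mem _, by rw [map_zero, zsmul_zero], ?_⟩
    rw [sub_zero]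
    exact AddSubgroup.mem_iInf.2 fun v ↦ AddSubgroup.mem_iInf.2 fun hv ↦ (hex ⟨v, hv⟩).elim
  obtain ⟨v₀, hv₀⟩ := hex
  have huniq : ∀ v : HeightOneSpectrum (𝓞 ℚ), ((2 : ℕ) : 𝓞 ℚ) ∈ v.asIdeal → v = v₀ :=
    fun v hv ↦ eq_of_two_mem_asIdeal' hv hv₀
  -- a local lift `g` of `γ` at `v₀`; `conj_γ = conj_{res g}` on `H¹(ℚ_∞, E[2^∞])`
  obtain ⟨g, hg⟩ := hκ.exists_isTopGenerator_resGalOfEmb_adicCompletion v₀ hv₀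
  have hconj : E.conjH1 2 κ.kerSubgroup γ c =
      E.conjH1 2 κ.kerSubgroup (resGalOfEmb (closureEmb (K := ℚ) (v₀.adicCompletion ℚ)) g) c :=
    SignedKatoOffTwo.KummerPoint.conjH1_eq_conjH1_resGalOfEmb E κ v₀ g γ (by rw [hγ, hg]) c
  -- `ψ_u c` at `v₀` (`σ = 1`)
  have hψv₀ : u • E.conjH1 2 κ.kerSubgroup (resGal (K := ℚ) (v₀.adicCompletion ℚ) g) c - c ∈
      localKummerOverOfEmb E 2 κ.kerSubgroup (closureEmb (K := ℚ) (v₀.adicCompletion ℚ))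
        (⨆ n : ℕ, signedLocalPoints κ (v₀.adicCompletion ℚ) E 1 n) := by
    have h1 := AddSubgroup.mem_iInf.1 (AddSubgroup.mem_iInf.1 (AddSubgroup.mem_iInf.1 hψ v₀) hv₀) 1
    rw [AddSubgroup.mem_comap, E.conjH1_of_mem_holds 2 κ.kerSubgroup (one_mem _), AddMonoidHom.id_apply, hconj] at h1
    exact h1
  -- (R3): the local target `x₀` at a fixed level `J₀`
  have hu' : ((2 : ℕ) : ℤ) ∣ u - 1 := by exact_mod_cast hu
  obtain ⟨J₀, x₀, hx₀⟩ := TwistedLocalDescent.exists_twistedTorsion_localLift_plusKummer_two_incl E κ hss ha hκ v₀ hv₀ hg hu'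
    c hψv₀
  -- the eventual global lifting with the prescribed class `x₀` at `v₀` modulo the `+` condition
  let x : ∀ v : HeightOneSpectrum (𝓞 ℚ),
      galoisCohomology ((E.twistedTorsionGaloisModule 2 κ J₀ u hu).restrictField (v.adicCompletion ℚ)) 1 :=
    fun v ↦ if h : v = v₀ then h ▸ x₀ else 0
  have hxv₀ : x v₀ = x₀ := by simp only [x, dif_pos]
  obtain ⟨J', hJ, y, hyH, hyloc⟩ := hev J₀ x
  have hy₀ := hyloc v₀ hv₀
  rw [hxv₀] at hy₀
  -- `c' = twistedTorsionToH1 y`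
  refine ⟨E.twistedTorsionToH1 2 κ J' u hu y, hyH, E.zsmul_conjH1_twistedTorsionToH1 2 κ J' u hu hγ y, ?_⟩
  refine mem_iInf_comap_conjH1_localKummer_of_forall_mem E κ hκ 1 fun v hv ↦ ?_
  obtain rfl := huniq v hv
  exact hx₀ J' hJ y hy₀

/-- **(LIFT⁺₂)(u) from H-PLUSDUAL-nondeg(u) and H-FIN(u)**: `liftPlusTwo_of_liftPlusEventual` fed by the lead's
`liftPlusEventual_two_of_plusDualNondeg_of_eigen` (p661592) at `ε = 1`; the binders `hdual` (WITH `hnondeg`) and `hfinE` are VERBATIM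
those of that theorem / of `hlevEventual_two_of_plusDualNondeg_of_eigen` (p661143); `hS` = the bad places lie in `S₀`.
[cite: GreenbergLNM1716, §4 Props. 4.13–4.14 and p. 124] [cite: Howard2004HeegnerKolyvagin, Thm. 2.1.11] [cite: Kobayashi2003, Def. 1.1] -/
theorem liftPlusTwo_of_plusDualNondeg_of_eigen (E : WeierstrassCurve ℚ) [E.IsElliptic] [E.IsGloballyMinimal]
    (hss : Rank1Residual.GoodSS E 2) (ha : E.frobeniusTrace 2 = 0) (S₀ : Finset (HeightOneSpectrum (𝓞 ℚ)))
    (κ : ZpExtension ℚ 2) (hκ : κ.IsCyclotomic) {γ : Field.absoluteGaloisGroup ℚ} (hγ : κ.IsTopGenerator γ) (u : ℤ)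
    (hu : (2 : ℤ) ∣ u - 1) (hS2 : ∀ v ∈ S₀, ((2 : ℕ) : 𝓞 ℚ) ∉ v.asIdeal)
    (hS : ∀ v : HeightOneSpectrum (𝓞 ℚ), ¬ E.HasGoodReductionAt v → v ∈ S₀)
    (hdual : ∀ (J : ℕ) (u' : ℤ) (hu' : (2 : ℤ) ∣ u' - 1) (huu' : ((2 : ℤ) ^ J) ∣ u * u' - 1)
      (e : E.geomTorsion ((2 ^ J : ℕ) : ℤ) → E.geomTorsion ((2 ^ J : ℕ) : ℤ) → AlgebraicClosure ℚ)
      (hμ : ∀ S T, e S T ^ (2 ^ J) = 1) (hadd₁ : ∀ S₁ S₂ T, e (S₁ + S₂) T = e S₁ T * e S₂ T)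
      (hadd₂ : ∀ S T₁ T₂, e S (T₁ + T₂) = e S T₁ * e S T₂)
      (hgal : ∀ (σ : absoluteGaloisGroup ℚ) (S T : E.geomTorsion ((2 ^ J : ℕ) : ℤ)), σ • e S T = e (σ • S) (σ • T))
      (hnondeg : ∀ T, (∀ S, e S T = 1) → T = 0)
      [Finite (E.geomTorsion ((2 ^ J : ℕ) : ℤ))]
      (inv : LocalInvariants ℚ (2 ^ J)), inv.IsPerfect → inv.SumLocalTermEqZero → inv.UnramifiedOrthogonal →
      ∀ (v : HeightOneSpectrum (𝓞 ℚ)), ((2 : ℕ) : 𝓞 ℚ) ∈ v.asIdeal →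
      ∀ y' : galoisCohomology ((E.twistedTorsionGaloisModule 2 κ J u' hu').restrictField (v.adicCompletion ℚ)) 1,
        galoisCohomology.map ((E.twistedWeilDual 2 κ J hu hu' huu' e hμ hadd₁ hadd₂ hgal).restrictField (v.adicCompletion ℚ)) 1 y' ∈
            inv.dualLocalCondition (E.twistedTorsionGaloisModule 2 κ J u hu) (Sum.inr v)
              (E.twistedTorsionLocalKummer 2 κ J u hu (v.adicCompletion ℚ)
                (⨆ n : ℕ, signedLocalPoints κ (v.adicCompletion ℚ) E 1 n)) →
        y' ∈ E.twistedTorsionLocalKummer 2 κ J u' hu' (v.adicCompletion ℚ) (⨆ n : ℕ, signedLocalPoints κ (v.adicCompletion ℚ) E 1 n))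
    (hfinE : ∃ e : ℕ, ∀ c ∈ unramifiedOutside κ.kerSubgroup ↥(E.geomPrimaryTorsion 2) 2 (↑S₀ : Set (HeightOneSpectrum (𝓞 ℚ))) ⊓
        ⨅ (v : HeightOneSpectrum (𝓞 ℚ)) (_ : ((2 : ℕ) : 𝓞 ℚ) ∈ v.asIdeal) (σ : Field.absoluteGaloisGroup ℚ),
          (localKummerOverOfEmb E 2 κ.kerSubgroup (closureEmb (K := ℚ) (v.adicCompletion ℚ))
            (⨆ n : ℕ, signedLocalPoints κ (v.adicCompletion ℚ) E 1 n)).comap (E.conjH1 2 κ.kerSubgroup σ),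
      E.conjH1 2 κ.kerSubgroup γ c = u • c → 2 ^ e • c = 0) :
    ∀ c ∈ unramifiedOutside κ.kerSubgroup ↥(E.geomPrimaryTorsion 2) 2 (↑S₀ : Set (HeightOneSpectrum (𝓞 ℚ))),
      u • E.conjH1 2 κ.kerSubgroup γ c - c ∈
        ⨅ (v : HeightOneSpectrum (𝓞 ℚ)) (_ : ((2 : ℕ) : 𝓞 ℚ) ∈ v.asIdeal) (σ : Field.absoluteGaloisGroup ℚ),
          (localKummerOverOfEmb E 2 κ.kerSubgroup (closureEmb (K := ℚ) (v.adicCompletion ℚ))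
            (⨆ n : ℕ, signedLocalPoints κ (v.adicCompletion ℚ) E 1 n)).comap (E.conjH1 2 κ.kerSubgroup σ) →
      ∃ c' ∈ unramifiedOutside κ.kerSubgroup ↥(E.geomPrimaryTorsion 2) 2 (↑S₀ : Set (HeightOneSpectrum (𝓞 ℚ))),
        u • E.conjH1 2 κ.kerSubgroup γ c' = c' ∧ c - c' ∈
          ⨅ (v : HeightOneSpectrum (𝓞 ℚ)) (_ : ((2 : ℕ) : 𝓞 ℚ) ∈ v.asIdeal) (σ : Field.absoluteGaloisGroup ℚ),
            (localKummerOverOfEmb E 2 κ.kerSubgroup (closureEmb (K := ℚ) (v.adicCompletion ℚ))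
              (⨆ n : ℕ, signedLocalPoints κ (v.adicCompletion ℚ) E 1 n)).comap (E.conjH1 2 κ.kerSubgroup σ) :=
  liftPlusTwo_of_liftPlusEventual E hss ha S₀ κ hκ hγ u hu
    (fun J x₂ ↦ liftPlusEventual_two_of_plusDualNondeg_of_eigen E hss S₀ κ hγ u hu 1 hS2 hS hdual hfinE J x₂)

end Summit.BirchSwinnertonDyer.BirchSwinnertonDyer.Theorems.SignedEC.TwistedPT

end
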